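import Literature.MathematicalPhysics.QuantumManyBody.PeriodicMaxFormTranslation
import Literature.MathematicalPhysics.QuantumManyBody.PeriodicMaxFormApproximation
import HarnessLib

/-!
# Translation-invariant core states approximating a translation-invariant class in the maximal form

Topic `Literature/MathematicalPhysics/QuantumManyBody`, sequel of `PeriodicMaxFormApproximation.lean`
(MaxFormApproximation: the normalised periodic `C¹` Bose core is dense in the unit sphere of the maximal form
domain, integrable interaction) and `PeriodicMaxFormTranslation.lean` (diagonal translations `T_b`). No
definitions, no named facts.

* `exists_symm_trigPoly_maxForm_approx_dominated` — the Bose-symmetric trigonometric approximants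
  `P = ∑_{n ∈ S} aₙ eₙ` of a bounded Bose-symmetric class `f` of `PeriodicMaxFormBoundBounded.lean`, with the
  additional (previously unexported) conclusion that the coefficients are DOMINATED, `|⟪eₙ, P⟫| ≤ |⟪eₙ, f⟫|`
  for every `n` — the approximation scheme is a Fourier MULTIPLIER `aₙ = m(n) f̂(n) 𝟙_{B_R}(n)`, `|m| ≤ 1`
  (`HaarTorus.exists_trigPoly_approx_of_bound`); consequently every spectral weight sum of `P` is at most
  that of `f`, and every vanishing Fourier coefficient of `f` vanishes for `P`;
* `sum_mul_cellWaveN_translate` — an `N`-body trigonometric polynomial on the cell all of whose frequencies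
  have zero total momentum `∑ᵢ n(i,·) = 0` is invariant under simultaneous translation of all particles;
* `exists_core_coe_eq_sum_mul_cellWaveN` — the core function `L^{-3N/2} ∑ aₙ e^{2πi n·X/L}` behind the
  embedded trigonometric polynomial `∑ aₙ eₙ` (`exists_core_formEmbed_eq_sum_smul`, with the function exposed);
* `exists_invariant_trialState_maxForm_approx` — **MaxFormApproximation in the zero-momentum sector**: for a
  UNIT Bose-symmetric `η` with `Q_w(η) < ∞` which is invariant under all diagonal translations `T_b`, and
  `ε > 0`, there is a periodic `C¹` Bose trial state `Φ` of ZERO TOTAL MOMENTUM (`Φ(x₁ + s, …, x_N + s) = Φ(X)`)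
  with `periodicEnergy w Φ ≤ Q_w(η) + ε` and `‖ιΦ - η‖ ≤ ε`. The approximation scheme of the tree (clamp
  truncation, then the symmetric Fourier multiplier) commutes with translations, so no averaging is needed.

## References

* B. Simon, J. Operator Theory 1 (1979) 37–47, Thm. 2.1 (maximal = minimal form). [Simon1979Forms]
* [ReedSimonIV1978] Reed–Simon IV, Thm. XIII.64; §XIII.16 (constant-fibre decomposition).
-/

noncomputable section

open MeasureTheory Filter Set Complex UnitAddTorus
open scoped ENNReal NNReal Topology InnerProductSpace
open Literature.Analysis.FunctionSpaces Literature.Analysis.OperatorTheory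

namespace Literature.MathematicalPhysics.QuantumManyBody.BoseGas

-- The measure on `ℝ/ℤ` is the Haar PROBABILITY measure, as in `PeriodicFormDomain.lean`.
attribute [local instance] formDomain_measureSpace formDomain_isProbabilityMeasure formDomain_isProbabilityMeasure_pi

variable {N : ℕ} {L : ℝ}

/-- Local notation for the Hilbert space `L²((ℝ/ℤ)^{3N})`, as in `PeriodicFormDomain.lean`. -/
local notation "L2T " N':max => Lp ℂ 2 (volume : Measure (UnitAddTorus (Fin N' × Fin 3)))

/-- The periodic interaction of a measurable profile is measurable (copy of the lemma of
`DiluteBoseGasUpperBoundLocalization.lean`, kept private to avoid that import). [folklore] -/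
private theorem measurable_periodicInteraction_zm {v : ℝ → ℝ≥0∞} (hv : Measurable v) (L : ℝ) :
    Measurable (periodicInteraction (N := N) v L) := by
  unfold periodicInteraction periodizedPotential
  refine Finset.measurable_sum _ fun i _ => Finset.measurable_sum _ fun j _ => ?_
  exact (Measurable.tsum fun n => hv.comp (measurable_id.sub_const _).norm).comp
    ((measurable_config_apply i).sub (measurable_config_apply j))

/-! ### Coefficient-dominated symmetric trigonometric approximation -/

/-- **Bounded Bose-symmetric classes are approximated in the maximal form by Bose-symmetric trigonometric
polynomials with DOMINATED coefficients.** Let `L > 0`, `w` a measurable profile with `∫_{[0,L)^{3N}} W < ∞`,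
`W = periodicInteraction w L`, and `f ∈ L²((ℝ/ℤ)^{3N})` with `‖f‖ ≤ C` a.e. and Bose-symmetric Fourier
coefficients. For every `ε > 0` there is `P = ∑_{n ∈ S} aₙ eₙ` (`S` stable under the particle permutations, `a`
invariant) with `|⟪eₙ, P⟫| ≤ |⟪eₙ, f⟫|` for all `n`, `∫ (W ∘ fromUnitTorusN L)|P|² ≤ ∫ (W ∘ fromUnitTorusN L)|f|² + ε`
and `‖P - f‖ ≤ ε`. [cite: ReedSimonIV1978, Thm. XIII.64] -/
theorem exists_symm_trigPoly_maxForm_approx_dominated (hL : 0 < L) {w : ℝ → ℝ≥0∞} (hw : Measurable w)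
    (hWint : ∫⁻ X in cellN N L, periodicInteraction w L X ≠ ⊤) (f : L2T N) {C : ℝ}
    (hC : ∀ᵐ t ∂(volume : Measure (UnitAddTorus (Fin N × Fin 3))), ‖(f : UnitAddTorus (Fin N × Fin 3) → ℂ) t‖ ≤ C)
    (hsymm : ∀ (σ : Equiv.Perm (Fin N)) (n : Fin N × Fin 3 → ℤ),
      ⟪(mFourierLp 2 (fun p : Fin N × Fin 3 => n (σ p.1, p.2)) : L2T N), f⟫_ℂ = ⟪(mFourierLp 2 n : L2T N), f⟫_ℂ)
    {ε : ℝ} (hε : 0 < ε) :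
    ∃ (S : Finset (Fin N × Fin 3 → ℤ)) (a : (Fin N × Fin 3 → ℤ) → ℂ),
      (∀ (σ : Equiv.Perm (Fin N)) (n : Fin N × Fin 3 → ℤ), n ∈ S → (fun p => n (σ p.1, p.2)) ∈ S) ∧
      (∀ (σ : Equiv.Perm (Fin N)) (n : Fin N × Fin 3 → ℤ), a (fun p => n (σ p.1, p.2)) = a n) ∧
      (∀ n : Fin N × Fin 3 → ℤ, ‖⟪(mFourierLp 2 n : L2T N), ∑ m ∈ S, a m • (mFourierLp 2 m : L2T N)⟫_ℂ‖ ≤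
        ‖⟪(mFourierLp 2 n : L2T N), f⟫_ℂ‖) ∧
      (∫⁻ t, periodicInteraction w L (fromUnitTorusN L t) *
          (‖((∑ m ∈ S, a m • (mFourierLp 2 m : L2T N) : L2T N) : UnitAddTorus (Fin N × Fin 3) → ℂ) t‖₊ : ℝ≥0∞) ^ 2 ≤
        (∫⁻ t, periodicInteraction w L (fromUnitTorusN L t) *
          (‖(f : UnitAddTorus (Fin N × Fin 3) → ℂ) t‖₊ : ℝ≥0∞) ^ 2) + ENNReal.ofReal ε) ∧
      ‖(∑ m ∈ S, a m • (mFourierLp 2 m : L2T N)) - f‖ ≤ ε := by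
  classical
  -- notation
  set Wt : UnitAddTorus (Fin N × Fin 3) → ℝ≥0∞ := fun t => periodicInteraction w L (fromUnitTorusN L t) with hWt
  set POT : L2T N → ℝ≥0∞ := fun g => ∫⁻ t, Wt t * (‖(g : UnitAddTorus (Fin N × Fin 3) → ℂ) t‖₊ : ℝ≥0∞) ^ 2
    with hPOT
  have hWtm : Measurable Wt := (measurable_periodicInteraction_zm hw L).comp (measurable_fromUnitTorusN L)
  have hWtint : ∫⁻ t, Wt t ≠ ⊤ := lintegral_periodicInteraction_fromUnitTorusN_ne_top hL hw hWint
  -- the approximating trigonometric polynomials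
  have hδ : ∀ j : ℕ, (0 : ℝ) < 1 / ((j : ℝ) + 1) := fun j => by positivity
  choose R m hm1 hmσ hsup hdist using fun j : ℕ => HaarTorus.exists_trigPoly_approx_of_bound f hC (hδ j)
  set box : ℕ → Finset (Fin N × Fin 3 → ℤ) := fun j => Fintype.piFinset fun _ : Fin N × Fin 3 => Finset.Icc (-(R j : ℤ)) (R j)
    with hbox
  set a : ℕ → (Fin N × Fin 3 → ℤ) → ℂ := fun j n => m j n * mFourierCoeff f n with ha
  set P : ℕ → L2T N := fun j => ∑ n ∈ box j, a j n • (mFourierLp 2 n : L2T N) with hP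
  -- (i) `P j → f` in `L²`
  have hPf : Tendsto P atTop (𝓝 f) := by
    rw [tendsto_iff_norm_sub_tendsto_zero]
    refine squeeze_zero (fun j => norm_nonneg _) (fun j => hdist j) tendsto_one_div_add_atTop_nhds_zero_nat
  -- (ii) `P j` is bounded by `C + 1` a.e.
  have hPbd : ∀ j, ∀ᵐ t ∂(volume : Measure (UnitAddTorus (Fin N × Fin 3))),
      ‖(P j : UnitAddTorus (Fin N × Fin 3) → ℂ) t‖ ≤ C + 1 := fun j => by
    filter_upwards [HaarTorus.coeFn_sum_smul_mFourierLp (box j) (a j)] with t ht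
    simp only [hP]
    rw [ht]
    refine (hsup j t).trans (add_le_add le_rfl ?_)
    rw [div_le_one (by positivity)]
    linarith [(Nat.cast_nonneg j : (0 : ℝ) ≤ j)]
  -- (iii) symmetry of boxes and coefficients
  have hboxσ : ∀ j (σ : Equiv.Perm (Fin N)) (n : Fin N × Fin 3 → ℤ), n ∈ box j →
      (fun p : Fin N × Fin 3 => n (σ p.1, p.2)) ∈ box j := fun j σ n hn => by
    rw [← comp_prodCongr_eq]
    exact (HaarTorus.comp_perm_mem_box_iff (R j) _ n).2 hn
  have haσ : ∀ j (σ : Equiv.Perm (Fin N)) (n : Fin N × Fin 3 → ℤ), a j (fun p => n (σ p.1, p.2)) = a j n := by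
    intro j σ n
    simp only [ha]
    rw [← comp_prodCongr_eq, hmσ j, comp_prodCongr_eq, ← HaarTorus.inner_mFourierLp_eq_mFourierCoeff,
      ← HaarTorus.inner_mFourierLp_eq_mFourierCoeff, hsymm]
  -- (iv) the coefficients are dominated by those of `f`
  have hdom : ∀ j n, ‖⟪(mFourierLp 2 n : L2T N), P j⟫_ℂ‖ ≤ ‖⟪(mFourierLp 2 n : L2T N), f⟫_ℂ‖ := by
    intro j n
    simp only [hP]
    rw [HaarTorus.inner_mFourierLp_sum_smul, HaarTorus.inner_mFourierLp_eq_mFourierCoeff]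
    split_ifs
    · simp only [ha, norm_mul]
      exact mul_le_of_le_one_left (norm_nonneg _) (hm1 j n)
    · rw [norm_zero]
      exact norm_nonneg _
  -- (v) the potential energies converge along an a.e.-convergent subsequence
  obtain ⟨φ, hφ, hae⟩ := (tendstoInMeasure_of_tendsto_Lp hPf).exists_seq_tendsto_ae
  have hpot : Tendsto (fun i => POT (P (φ i))) atTop (𝓝 (POT f)) := by
    refine tendsto_lintegral_of_dominated_convergence' (fun t => Wt t * ENNReal.ofReal ((C + 1) ^ 2))
      (fun i => hWtm.aemeasurable.mul
        ((Lp.aestronglyMeasurable (P (φ i))).aemeasurable.nnnorm.coe_nnreal_ennreal.pow_const 2)) ?_ ?_ ?_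
    · intro i
      filter_upwards [hPbd (φ i)] with t ht
      refine mul_le_mul_right ?_ _
      rw [coe_nnnorm_sq_eq_ofReal]
      exact ENNReal.ofReal_le_ofReal (pow_le_pow_left₀ (norm_nonneg _) ht 2)
    · rw [lintegral_mul_const _ hWtm]
      exact ENNReal.mul_ne_top hWtint ENNReal.ofReal_ne_top
    · filter_upwards [hae, ae_lt_top hWtm hWtint] with t ht hWfin
      have hsq : Tendsto (fun i => (‖(P (φ i) : UnitAddTorus (Fin N × Fin 3) → ℂ) t‖₊ : ℝ≥0∞) ^ 2) atTop
          (𝓝 ((‖(f : UnitAddTorus (Fin N × Fin 3) → ℂ) t‖₊ : ℝ≥0∞) ^ 2)) :=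
        ((ENNReal.continuous_pow 2).tendsto _).comp ((ENNReal.continuous_coe.tendsto _).comp ht.nnnorm)
      exact ENNReal.Tendsto.const_mul hsq (Or.inr hWfin.ne)
  -- (vi) pick an index far enough along the subsequence
  have hev1 : ∀ᶠ i in atTop, POT (P (φ i)) ≤ POT f + ENNReal.ofReal ε := by
    by_cases htop : POT f = ⊤
    · exact Eventually.of_forall fun i => by rw [htop, top_add]; exact le_top
    · exact ((tendsto_order.1 hpot).2 _ (ENNReal.lt_add_right htop (by simpa using hε))).mono fun i hi => hi.le
  have hev2 : ∀ᶠ i in atTop, ‖P (φ i) - f‖ ≤ ε :=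
    (tendsto_iff_norm_sub_tendsto_zero.1 (hPf.comp hφ.tendsto_atTop)).eventually (Iic_mem_nhds hε)
  obtain ⟨i, hi1, hi2⟩ := (hev1.and hev2).exists
  have h5 := hdom (φ i)
  simp only [hP] at h5
  simp only [hPOT, hWt, hP] at hi1
  simp only [hP] at hi2
  exact ⟨box (φ i), a (φ i), hboxσ (φ i), haσ (φ i), h5, hi1, hi2⟩

/-- Dominated coefficients give dominated spectral weight sums: `∑ₙ wₙ |⟪eₙ, P⟫|² ≤ ∑ₙ wₙ |⟪eₙ, f⟫|²`. [folklore] -/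
theorem tsum_weight_le_of_dominated {P f : L2T N}
    (hdom : ∀ n : Fin N × Fin 3 → ℤ, ‖⟪(mFourierLp 2 n : L2T N), P⟫_ℂ‖ ≤ ‖⟪(mFourierLp 2 n : L2T N), f⟫_ℂ‖)
    (w : (Fin N × Fin 3 → ℤ) → ℝ≥0∞) :
    ∑' n : Fin N × Fin 3 → ℤ, w n * ((‖⟪(mFourierLp 2 n : L2T N), P⟫_ℂ‖₊ : ℝ≥0∞)) ^ 2 ≤
      ∑' n : Fin N × Fin 3 → ℤ, w n * ((‖⟪(mFourierLp 2 n : L2T N), f⟫_ℂ‖₊ : ℝ≥0∞)) ^ 2 :=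
  ENNReal.tsum_le_tsum fun n => mul_le_mul_right (pow_le_pow_left' (ENNReal.coe_le_coe.2 (hdom n)) 2) _

/-! ### Trigonometric polynomials of zero total momentum on the cell -/

/-- `toUnitTorusN` of a simultaneous translation is a diagonal shift. [folklore] -/
theorem toUnitTorusN_translate (L : ℝ) (X : Config N) (s : Space) :
    toUnitTorusN L (fun i => X i + s) = toUnitTorusN L X + diagShift N (toUnitTorus L s) := by
  have h : (fun i => X i + s) = X + fun _ => s := rfl
  rw [h, toUnitTorusN_add]
  rfl

/-- **A plane wave of zero total momentum is invariant under simultaneous translations**: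
`e_n(x₁ + s, …, x_N + s) = e_n(X)` if `∑ᵢ n(i,·) = 0`. [folklore] -/
theorem cellWaveN_translate_of_totalMomentum_eq_zero (L : ℝ) {n : Fin N × Fin 3 → ℤ}
    (hn : (fun k => ∑ i, n (i, k)) = 0) (X : Config N) (s : Space) :
    cellWaveN L n (fun i => X i + s) = cellWaveN L n X := by
  unfold cellWaveN
  rw [toUnitTorusN_translate, mFourier_apply_add, mFourier_diagShift, hn, mFourier_zero, ContinuousMap.one_apply,
    mul_one]

/-- **An `N`-body trigonometric polynomial whose non-vanishing frequencies all have zero total momentum is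
invariant under simultaneous translation of all particles** (total momentum `0`). [folklore] -/
theorem sum_mul_cellWaveN_translate (L : ℝ) {S : Finset (Fin N × Fin 3 → ℤ)} {a : (Fin N × Fin 3 → ℤ) → ℂ}
    (ha0 : ∀ n ∈ S, (fun k => ∑ i, n (i, k)) ≠ 0 → a n = 0) (c : ℂ) (X : Config N) (s : Space) :
    c * ∑ n ∈ S, a n * cellWaveN L n (fun i => X i + s) = c * ∑ n ∈ S, a n * cellWaveN L n X := by
  congr 1
  refine Finset.sum_congr rfl fun n hn => ?_
  by_cases h : (fun k => ∑ i, n (i, k)) = 0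
  · rw [cellWaveN_translate_of_totalMomentum_eq_zero L h]
  · rw [ha0 n hn h, zero_mul, zero_mul]

/-- **Bose-symmetric trigonometric polynomials are embedded core functions** (the core function exposed): for
`S` stable under the particle permutations and `a` invariant, the core function
`Ψ = L^{-3N/2} ∑_{n ∈ S} aₙ e^{2πi n·X/L}` has `ι(graphEmbed Ψ) = ∑_{n ∈ S} aₙ eₙ`. [folklore] -/
theorem exists_core_coe_eq_sum_mul_cellWaveN (hL : 0 < L) {v : ℝ → ℝ≥0∞} (hv : Measurable v)
    (hW : ∫⁻ X in cellN N L, periodicInteraction v L X ≠ ⊤) {S : Finset (Fin N × Fin 3 → ℤ)}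
    {a : (Fin N × Fin 3 → ℤ) → ℂ}
    (hS : ∀ (σ : Equiv.Perm (Fin N)) (n : Fin N × Fin 3 → ℤ), n ∈ S → (fun p => n (σ p.1, p.2)) ∈ S)
    (ha : ∀ (σ : Equiv.Perm (Fin N)) (n : Fin N × Fin 3 → ℤ), a (fun p => n (σ p.1, p.2)) = a n) :
    ∃ Ψ : periodicCore N L,
      ((Ψ : Config N → ℂ) = fun X => ((cellScale N L : ℂ))⁻¹ * ∑ n ∈ S, a n * cellWaveN L n X) ∧
      formEmbed hL hv hW ⟨graphEmbed hL hv hW Ψ, graphEmbed_mem_formDomain hL hv hW Ψ⟩ =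
        ∑ n ∈ S, a n • (mFourierLp 2 n : L2T N) := by
  set P : Config N → ℂ := fun X => ((cellScale N L : ℂ))⁻¹ * ∑ n ∈ S, a n * cellWaveN L n X with hP
  have hPmem : P ∈ periodicCore N L := by
    refine ⟨?_, ?_, ?_⟩
    · exact contDiff_const.mul (ContDiff.sum fun n _ => contDiff_const.mul (contDiff_cellWaveN L n))
    · intro X i k
      simp only [hP, cellWaveN_periodic hL.ne' _ X i k]
    · intro σ X
      simp only [hP, sum_mul_cellWaveN_comp_perm hS ha σ X]
  refine ⟨⟨P, hPmem⟩, rfl, Lp.ext ?_⟩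
  have hsc : cellScale N L ≠ 0 := by
    rw [cellScale]; exact (Real.sqrt_pos.2 (by positivity)).ne'
  filter_upwards [coeFn_formEmbed_graphEmbed hL hv hW ⟨P, hPmem⟩,
    Literature.Analysis.FunctionSpaces.HaarTorus.coeFn_sum_smul_mFourierLp S a] with t h1 h2
  rw [h1, h2]
  simp only [hP, cellWaveN, toUnitTorusN_fromUnitTorusN hL.ne', ← mul_assoc]
  rw [mul_inv_cancel₀ (by exact_mod_cast hsc), one_mul]

/-! ### MaxFormApproximation in the zero-momentum sector -/

/-- **MaxFormApproximation by states of zero total momentum.** For `L > 0`, measurable `w` with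
`∫_{[0,L)^{3N}} W < ∞`, a UNIT Bose-symmetric `η ∈ L²((ℝ/ℤ)^{3N})` with finite maximal form `Q_w(η)` which is
invariant under all diagonal translations (`T_b η = η`), and `ε > 0`, there is a periodic `C¹` Bose trial state
`Φ` of zero total momentum (`Φ(x₁ + s, …, x_N + s) = Φ(X)`) with `periodicEnergy w Φ ≤ Q_w(η) + ε` and
`‖ι(graphEmbed Φ) - η‖ ≤ ε` (`ι` built with any auxiliary admissible `(v, hv, hW)`): the clamp truncation and
the symmetric Fourier multiplier of the tree's scheme commute with translations. [cite: ReedSimonIV1978, Thm. XIII.64] -/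
theorem exists_invariant_trialState_maxForm_approx (hL : 0 < L) {v : ℝ → ℝ≥0∞} (hv : Measurable v)
    (hW : ∫⁻ X in cellN N L, periodicInteraction v L X ≠ ⊤) {w : ℝ → ℝ≥0∞} (hw : Measurable w)
    (hWint : ∫⁻ X in cellN N L, periodicInteraction w L X ≠ ⊤) (η : L2T N) (hη : ‖η‖ = 1)
    (hsymm : η ∈ boseSymmetric N) (hinv : ∀ b : UnitAddTorus (Fin 3), translateLp b η = η)
    (hfin : maxForm w L η ≠ ⊤) {ε : ℝ} (hε : 0 < ε) :
    ∃ Φ : PeriodicTrialState N L,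
      HasTotalMomentum 0 Φ.ψ ∧
      periodicEnergy w Φ ≤ maxForm w L η + ENNReal.ofReal ε ∧
      ‖formEmbed hL hv hW ⟨graphEmbed hL hv hW ⟨Φ.ψ, Φ.mem_periodicCore⟩, graphEmbed_mem_formDomain hL hv hW _⟩ - η‖ ≤ ε := by
  -- notation
  set Q : ℝ≥0∞ := maxForm w L η with hQdef
  set q : ℝ := Q.toReal with hqdef
  have hq0 : 0 ≤ q := ENNReal.toReal_nonneg
  have hQq : Q = ENNReal.ofReal q := (ENNReal.ofReal_toReal hfin).symm
  -- the accuracy `e = min (1/4) (ε / (6q + 3))`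
  set e : ℝ := min (1 / 4) (ε / (6 * q + 3)) with hedef
  have he0 : 0 < e := lt_min (by norm_num) (by positivity)
  have he4 : e ≤ 1 / 4 := min_le_left _ _
  have heε : e * (6 * q + 3) ≤ ε := by
    have h := min_le_right (1 / 4) (ε / (6 * q + 3))
    rw [← hedef] at h
    have h63 : 0 < 6 * q + 3 := by positivity
    calc e * (6 * q + 3) ≤ ε / (6 * q + 3) * (6 * q + 3) := mul_le_mul_of_nonneg_right h h63.le
      _ = ε := div_mul_cancel₀ ε h63.ne'
  have he2 : 2 * e ≤ ε := by nlinarith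
  -- a translation-invariant truncation `f = clampC k ∘ η` within `e/2` of `η`
  have he0' : 0 < e / 2 := half_pos he0
  obtain ⟨k, hk⟩ := ((tendsto_iff_norm_sub_tendsto_zero.1 (tendsto_clampLp η)).eventually (Iic_mem_nhds he0')).exists
  set f : L2T N := (lipschitzWith_clampC (k : ℝ)).compLp (clampC_zero (Nat.cast_nonneg k)) η with hf
  have hfinv : ∀ b : UnitAddTorus (Fin 3), translateLp b f = f := fun b => by
    rw [hf, ← compLp_translateLp, hinv b]
  have hfzero := (translateLp_eq_self_iff f).1 hfinv
  -- the dominated symmetric trigonometric polynomial `P` at accuracy `e/2` for `f`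
  obtain ⟨S, a, hS, ha, hdom, hpot, hdist⟩ := exists_symm_trigPoly_maxForm_approx_dominated hL hw hWint f
    (ae_norm_clampLp_le η k) (inner_symm_clampLp η k hsymm) he0'
  set P : L2T N := ∑ m ∈ S, a m • (mFourierLp 2 m : L2T N) with hPdef
  have ha0 : ∀ n ∈ S, (fun k => ∑ i, n (i, k)) ≠ 0 → a n = 0 := fun n hn htot => by
    have h := hdom n
    rw [hfzero n htot, norm_zero, HaarTorus.inner_mFourierLp_sum_smul, if_pos hn] at h
    exact norm_le_zero_iff.1 h
  have hQP : maxForm w L P ≤ Q + ENNReal.ofReal e := by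
    have hkin : maxFormKin L P ≤ maxFormKin L η :=
      (tsum_weight_le_of_dominated hdom _).trans (tsum_kinetic_clampLp_le η k)
    have hpot' : maxFormPot w L P ≤ maxFormPot w L η + ENNReal.ofReal e := by
      refine hpot.trans ((add_le_add (lintegral_pot_clampLp_le η k _) le_rfl).trans ?_)
      exact add_le_add le_rfl (ENNReal.ofReal_le_ofReal (by linarith))
    calc maxForm w L P = maxFormKin L P + maxFormPot w L P := rfl
      _ ≤ maxFormKin L η + (maxFormPot w L η + ENNReal.ofReal e) := add_le_add hkin hpot'
      _ = Q + ENNReal.ofReal e := (add_assoc _ _ _).symm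
  have hdistP : ‖P - η‖ ≤ e := by
    calc ‖P - η‖ ≤ ‖P - f‖ + ‖f - η‖ := norm_sub_le_norm_sub_add_norm_sub _ _ _
      _ ≤ e / 2 + e / 2 := add_le_add hdist hk
      _ = e := add_halves e
  -- `‖P‖` is close to `1`
  have hPnorm : |‖P‖ - 1| ≤ e := by
    rw [← hη]
    exact (abs_norm_sub_norm_le P η).trans hdistP
  have hPpos : 0 < ‖P‖ := by
    have := (abs_le.1 hPnorm).1
    linarith
  -- `P` is an embedded core function of zero total momentum; normalise it
  obtain ⟨Ψ, hΨcoe, hΨ⟩ := exists_core_coe_eq_sum_mul_cellWaveN hL hv hW hS ha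
  rw [← hPdef] at hΨ
  set c : ℝ := ‖P‖⁻¹ with hcdef
  have hc0 : 0 < c := inv_pos.2 hPpos
  set Φc : periodicCore N L := ((c : ℝ) : ℂ) • Ψ with hΦc
  have hιΦ : formEmbed hL hv hW ⟨graphEmbed hL hv hW Φc, graphEmbed_mem_formDomain hL hv hW Φc⟩ = ((c : ℝ) : ℂ) • P := by
    rw [← hΨ, ← map_smul]
    congr 1
    apply Subtype.ext
    simp only [hΦc, map_smul, SetLike.mk_smul_mk]
  have h1 : ‖formEmbed hL hv hW ⟨graphEmbed hL hv hW Φc, graphEmbed_mem_formDomain hL hv hW Φc⟩‖ = 1 := by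
    rw [hιΦ, norm_smul, Complex.norm_real, Real.norm_of_nonneg hc0.le, hcdef, inv_mul_cancel₀ hPpos.ne']
  have hcore : (⟨(PeriodicTrialState.ofCore hL hv hW Φc h1).ψ,
      (PeriodicTrialState.ofCore hL hv hW Φc h1).mem_periodicCore⟩ : periodicCore N L) = Φc := rfl
  refine ⟨PeriodicTrialState.ofCore hL hv hW Φc h1, ?_, ?_, ?_⟩
  · -- zero total momentum
    rw [hasTotalMomentum_zero_iff]
    intro s X
    have hψ : (PeriodicTrialState.ofCore hL hv hW Φc h1).ψ = fun X => ((c : ℝ) : ℂ) * (Ψ : Config N → ℂ) X := by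
      show ((Φc : periodicCore N L) : Config N → ℂ) = _
      rw [hΦc, Submodule.coe_smul]
      rfl
    rw [hψ]
    dsimp only
    rw [hΨcoe]
    dsimp only
    rw [← mul_assoc, ← mul_assoc, sum_mul_cellWaveN_translate L ha0]
  · -- the energy
    rw [periodicEnergy_eq_maxForm hL hv hW hw, hcore, hιΦ, tsum_weight_inner_smul, lintegral_weight_smul_sq, ← mul_add,
      Complex.norm_real, Real.norm_of_nonneg hc0.le]
    change ENNReal.ofReal (c ^ 2) * maxForm w L P ≤ Q + ENNReal.ofReal ε
    -- `c² (Q + e) ≤ (1 + 6e)(q + e) ≤ q + ε`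
    have hc2 : c ^ 2 ≤ 1 + 6 * e := by
      have hle : 1 - e ≤ ‖P‖ := by linarith [(abs_le.1 hPnorm).1]
      have h1e : 0 < 1 - e := by linarith
      calc c ^ 2 = (‖P‖ ^ 2)⁻¹ := by rw [hcdef, inv_pow]
        _ ≤ ((1 - e) ^ 2)⁻¹ := by
            refine inv_anti₀ (by positivity) ?_
            exact pow_le_pow_left₀ h1e.le hle 2
        _ ≤ 1 + 6 * e := inv_sq_one_sub_le he0.le he4
    calc ENNReal.ofReal (c ^ 2) * maxForm w L P ≤ ENNReal.ofReal (1 + 6 * e) * (Q + ENNReal.ofReal e) :=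
          mul_le_mul' (ENNReal.ofReal_le_ofReal hc2) hQP
      _ = ENNReal.ofReal ((1 + 6 * e) * (q + e)) := by
          rw [hQq, ← ENNReal.ofReal_add hq0 he0.le, ← ENNReal.ofReal_mul (by linarith)]
      _ ≤ ENNReal.ofReal (q + ε) := by
          refine ENNReal.ofReal_le_ofReal ?_
          nlinarith [mul_nonneg he0.le hq0]
      _ = Q + ENNReal.ofReal ε := by rw [ENNReal.ofReal_add hq0 hε.le, ← hQq]
  · -- the distance
    rw [hcore, hιΦ]
    calc ‖((c : ℝ) : ℂ) • P - η‖ ≤ ‖((c : ℝ) : ℂ) • P - P‖ + ‖P - η‖ := norm_sub_le_norm_sub_add_norm_sub _ _ _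
      _ = |c - 1| * ‖P‖ + ‖P - η‖ := by
          rw [show ((c : ℝ) : ℂ) • P - P = (((c - 1 : ℝ)) : ℂ) • P by
            rw [Complex.ofReal_sub, Complex.ofReal_one, sub_smul, one_smul], norm_smul, Complex.norm_real,
            Real.norm_eq_abs]
      _ = |1 - ‖P‖| + ‖P - η‖ := by
          rw [hcdef, show ‖P‖⁻¹ - 1 = (1 - ‖P‖) * ‖P‖⁻¹ by field_simp, abs_mul, abs_of_pos (inv_pos.2 hPpos),
            mul_assoc, inv_mul_cancel₀ hPpos.ne', mul_one]
      _ ≤ e + e := add_le_add (by rw [abs_sub_comm]; exact hPnorm) hdistP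
      _ ≤ ε := by linarith

end Literature.MathematicalPhysics.QuantumManyBody.BoseGas
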